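import Summits.CriticalPhenomena.CardyFormulaZ2.Theorems.CardyBondTriangularBondTriangularCardySandwichLower
import Summits.CriticalPhenomena.CardyFormulaZ2.Theorems.CardyBondTriangularBondTriangularCardyStubSeparatesOfIsPath
import HarnessLib

/-!
# Route CardyBondTriangular · crux `BondTriangularCardy` (stmt-CriticalPhenomena-4664), line `birth`,
# stub `stub_sandwichUpper`, I: the sneaking event and the upper half of the sandwich at a fixed mesh

Helper of the stub `stub_sandwichUpper` (the upper half `P_{p_c}(crude crossing) ≤ f⁺¹_δ(z⁺_δ) + e(δ)`
of Bollobás–Riordan's sandwich (19) p. 184 with (40) p. 201, *Percolation*, CUP 2006, Ch. 7, for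
critical bond percolation on `𝕋` in its Chayes–Lei hexagon representation and the route's crude
crossing event `embDomainCrossing` at mesh `δ/√3`), first file; the assembly over a family of
shorter–fatter discrete approximations is the sibling `…UpperOfNoSneak.lean`, whose module
docstring explains the design and why one estimate (`PartSig.noSneak`) is isolated rather than
proved.

Contents. `PartSig.clDuality` (verbatim the text of the lead's registered stub signature
`Sig.stub_clDuality`: the Chayes–Lei duality lemma); the **sneaking event** `sneakEvent R G δ ρ`
(a crude open crossing of `Ω` coexisting with a blue stretch-1→stretch-3 crossing of `G` staying
`ρ`-far from the marked points) and the **sneaking estimate** `PartSig.noSneak` (its probability is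
`o(1)`); `stretch_two_subset_dropLast_stretch_two`; `clSepEvent_one_of_yellowCrossing` (a yellow
stretch-0→stretch-2 crossing of a 4-marked domain avoiding the ball about the triangle `z` lies in
`E¹(z)` of the 3-marked domain, by the LANDED blocking theorem `stub_separatesOfIsPath` applied to
the reversed crossing made simple); and the fixed-mesh estimate `crude_real_le_clSepProb_add`:
`P_{p_c}(crude) ≤ f¹(z) + P(local yellow arm) + Σⱼ P(blue corner arm at R.pt j) + P_{p_c}(sneakEvent)`
for a shorter–fatter `G` (duality splits the configurations with a crude crossing into those with a
yellow crossing — in `E¹(z)` unless it meets the ball about `z` — and those with a blue crossing —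
a blue corner arm unless all its hexagons are far from the corners, i.e. `sneakEvent`; the arm
probabilities are pulled back to the hexagon model by `bond_real_preimage_clOfBond_le`).

References: B. Bollobás, O. Riordan, *Percolation*, CUP 2006, Ch. 7, Lemma 5 p. 169, (19)
p. 184, Claims 19–21 pp. 192–193, remark p. 195, (40) p. 201; L. Chayes, H. K. Lei, Rev. Math.
Phys. 19 (2007) §2.1.
-/

noncomputable section

namespace Summit.CriticalPhenomena.CardyFormulaZ2.Theorems.BondTriangularCardyLine

open Set Filter Topology Metric MeasureTheory
open Literature.Probability.Percolation Literature.Probability.RandomPlanarGeometry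
open Literature.Probability.RandomPlanarGeometry.MarkedDomain
open Literature.Probability.LatticeModels

/-! ### The hypotheses and the isolated estimate, as propositions -/

/-- **The Chayes–Lei duality lemma** (existence half of Bollobás–Riordan's Lemma 5 for the
hexagon model with half-edge connectivity), verbatim the text of the lead's registered stub
signature `Sig.stub_clDuality` (line `birth`, reshape v4): in a 4-marked discrete domain every
configuration has a yellow stretch-0→stretch-2 crossing or a blue stretch-1→stretch-3 crossing.
(ref: BollobasRiordan2006, Ch. 7 Lemma 5 p. 169; ChayesLei2007 §2.1) -/
def PartSig.clDuality : Prop :=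
  ∀ (G : Literature.Probability.Percolation.TriMarkedDomain 4) (σ : Literature.Probability.Percolation.CLHexConfig), (∃ (du dv : Literature.Probability.LatticeModels.Site 2 × Literature.Probability.LatticeModels.Site 2) (P : Literature.Probability.LatticeModels.triGraph.Walk du.1 dv.1), du ∈ G.stretch 0 ∧ dv ∈ G.stretch 2 ∧ Literature.Probability.Percolation.YellowTowards σ du ∧ Literature.Probability.Percolation.YellowTowards σ dv ∧ (∀ x ∈ P.support, x ∈ G.verts ∧ σ x ≠ Literature.Probability.Percolation.CLHexState.B) ∧ ∀ d ∈ P.darts, (Literature.Probability.Percolation.clYellowGraph σ).Adj d.fst d.snd) ∨ (∃ (du dv : Literature.Probability.LatticeModels.Site 2 × Literature.Probability.LatticeModels.Site 2) (P : Literature.Probability.LatticeModels.triGraph.Walk du.1 dv.1), du ∈ G.stretch 1 ∧ dv ∈ G.stretch 3 ∧ Literature.Probability.Percolation.BlueTowards σ du ∧ Literature.Probability.Percolation.BlueTowards σ dv ∧ (∀ x ∈ P.support, x ∈ G.verts ∧ σ x ≠ Literature.Probability.Percolation.CLHexState.Y) ∧ ∀ d ∈ P.darts, (Literature.Probability.Percolation.clBlueGraph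 σ).Adj d.fst d.snd)

/-- **The sneaking event** of a 4-marked domain `G ⊆ δ𝕋` relative to the conformal rectangle `R`
at corner radius `ρ`: the lattice bond configuration `ω ⊆ E(𝕋)` has a crude open crossing of
`Ω` at mesh `δ/√3` from `A₀` to `A₂` (the route's `embDomainCrossing` for the embedding
`√3 (triEmbed · - (1+ζ)/3)`) AND, in its Chayes–Lei packaging `clOfBond ω`, a blue crossing of
`G` from its stretch `1` to its stretch `3` — a `𝕋`-walk of hexagons of `G`, none pure yellow,
consecutive ones sharing a blue (half-)edge, its end hexagons showing blue towards the two
stretch darts — all of whose hexagons are at distance `≥ ρ` from the four marked points of `R`.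
(For Bollobás–Riordan's own crossing notion and a shorter–fatter `G` far from the corners this
event is EMPTY, Claim 19 p. 192; for the crude event it need not be, see the module docstring.)
(ref: BollobasRiordan2006, Ch. 7 Claim 19 p. 192, remark p. 195) -/
def sneakEvent (R : ConformalRectangle) (G : TriMarkedDomain 4) (δ ρ : ℝ) : Set (BondConfig (Site 2)) :=
  {ω | ω ⊆ triGraph.edgeSet ∧
    ω ∈ embDomainCrossing (fun x : Site 2 ↦ (Real.sqrt 3 : ℂ) * (triEmbed x - (1 + triZeta) / 3))
      R.carrier (δ / Real.sqrt 3) (R.arc 0) (R.arc 2) ∧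
    ∃ (du dv : Site 2 × Site 2) (P : triGraph.Walk du.1 dv.1), du ∈ G.stretch 1 ∧ dv ∈ G.stretch 3 ∧
      BlueTowards (clOfBond ω) du ∧ BlueTowards (clOfBond ω) dv ∧
      (∀ x ∈ P.support, x ∈ G.verts ∧ clOfBond ω x ≠ CLHexState.Y ∧
        ∀ j : Fin 4, ρ ≤ dist (triMeshPoint δ x) (R.pt j)) ∧
      ∀ d ∈ P.darts, (clBlueGraph (clOfBond ω)).Adj d.fst d.snd}

/-- **The sneaking estimate (the isolated remaining content of the stub `stub_sandwichUpper`).**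
For critical bond percolation on `𝕋`, every conformal rectangle `R`, every discrete
approximation `G⁺_δ` of `R` which is eventually shorter–fatter at every precision and corner
radius, and every `ρ > 0`: the probability that a crude open crossing of `Ω` from `A₀` to `A₂`
coexists with a blue Chayes–Lei crossing of `G⁺_δ` from stretch `1` to stretch `3` staying
`ρ`-far from the marked points tends to `0` as `δ → 0⁺` (`sneakEvent`). This is the probability
form of the second half of Bollobás–Riordan's Claim 19 ("`P` intersects any crossing of `D` from
`A₂` to `A₄`", p. 192) for the route's crude event; configurationwise it fails through sub-mesh
folds of `∂Ω` (module docstring), and its proof is expected to need a boundary three-arm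
estimate uniformly over boundary locations. OPEN. (ref: BollobasRiordan2006, Ch. 7 Claim 19 p. 192, remark p. 195) -/
def PartSig.noSneak : Prop :=
  ∀ (R : Literature.Probability.RandomPlanarGeometry.ConformalRectangle) (Gp : ℝ → Literature.Probability.Percolation.TriMarkedDomain 4),
    Literature.Probability.Percolation.IsDiscreteApprox R Gp →
    (∀ ρ > (0 : ℝ), ∀ t > (0 : ℝ), ∀ᶠ δ : ℝ in nhdsWithin (0 : ℝ) (Set.Ioi 0), (Gp δ).IsShorterFatter R δ t ρ) →
    ∀ ρ > (0 : ℝ), Filter.Tendsto (fun δ : ℝ => (Literature.Probability.Percolation.bondPercolation Literature.Probability.LatticeModels.triGraph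
        (Literature.Probability.LatticeModels.criticalWeightI (Real.pi / 6))).real (sneakEvent R (Gp δ) δ ρ))
      (nhdsWithin (0 : ℝ) (Set.Ioi 0)) (nhds 0)

/-! ### Combinatorial preliminaries -/

/-- Forgetting `v₃`: the stretch `2` of the 4-marked domain is contained in the (merged) stretch
`2` of the 3-marked one. -/
theorem stretch_two_subset_dropLast_stretch_two : ∀ (D : Literature.Probability.Percolation.TriMarkedDomain 4), D.stretch 2 ⊆ D.dropLast.stretch 2 := by
  intro D d hd
  obtain ⟨n, hn, rfl⟩ := Finset.mem_image.1 hd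
  rw [Finset.mem_Ico] at hn
  have h2 : D.nextPos 2 ≤ D.bdryLen := by
    unfold TriMarkedDomain.nextPos
    rw [dif_pos (show (2 : Fin 4).val + 1 < 4 by decide)]
    exact (D.pos_lt _).le
  refine Finset.mem_image.2 ⟨n, Finset.mem_Ico.2 ⟨?_, ?_⟩, rfl⟩
  · show D.pos 2 ≤ n
    exact hn.1
  · show n < D.dropLast.nextPos 2
    unfold TriMarkedDomain.nextPos
    rw [dif_neg (show ¬ ((2 : Fin 3).val + 1 < 3) by decide)]
    exact lt_of_lt_of_le hn.2 h2

/-- A walk all of whose darts are adjacencies of a second graph `H` joins every vertex of its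
support to both its ends in `H` (used for the blue graph; the yellow case is the landed
`clYellow_reachable_ends_of_darts`). -/
theorem reachable_ends_of_darts {V : Type*} {G H : SimpleGraph V} {u v : V} (P : G.Walk u v)
    (hdarts : ∀ d ∈ P.darts, H.Adj d.fst d.snd) {x : V} (hx : x ∈ P.support) :
    H.Reachable x u ∧ H.Reachable x v := by
  classical
  have hedges : ∀ e ∈ P.edges, e ∈ H.edgeSet := by
    intro e he
    rw [SimpleGraph.Walk.edges, List.mem_map] at he
    obtain ⟨d, hd, rfl⟩ := he
    rw [show d.edge = s(d.fst, d.snd) from rfl, SimpleGraph.mem_edgeSet]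
    exact hdarts d hd
  set Q := P.transfer H hedges with hQ
  have hxQ : x ∈ Q.support := by rw [hQ, SimpleGraph.Walk.support_transfer]; exact hx
  exact ⟨⟨(Q.takeUntil x hxQ).reverse⟩, ⟨Q.dropUntil x hxQ⟩⟩

/-! ### `E¹(z)` from a yellow stretch-0→stretch-2 crossing avoiding the ball about `z` -/

/-- **A yellow crossing avoiding the ball about `z` is in `E¹(z)`.** Let `G` be a 4-marked domain,
`z` a face of `G` whose three vertices lie in a set `S` of sites, one of them joined to the marked
site `v₃` by a path of sites of `G` inside `S`. If `σ` has a yellow crossing of `G` from a dart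
of stretch `0` to a dart of stretch `2` (hexagons of `G`, none pure blue, consecutive ones sharing
a yellow (half-)edge, ends showing yellow towards the stretch darts) avoiding `S`, then `σ` lies
in the separating event `E¹(z)` of the 3-marked domain `G.dropLast`: the reversed crossing made
simple is a yellow simple path from `A₂(G)` to `A₀(G)` which separates `z` from the stretch `1`
by the LANDED blocking theorem `stub_separatesOfIsPath`. -/
theorem clSepEvent_one_of_yellowCrossing (G : TriMarkedDomain 4)
    {z : HexVertex} {S : Set (Site 2)} (hface : hexFaceVertices z ⊆ G.verts)
    (hzS : ∀ y ∈ hexFaceVertices z, y ∈ S)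
    (hjoin : ∃ y ∈ hexFaceVertices z, PathIn triGraph (((G.verts : Set (Site 2)) ∩ S)) y (G.markSite 3))
    {σ : CLHexConfig} {du dv : Site 2 × Site 2} (P : triGraph.Walk du.1 dv.1)
    (hu : du ∈ G.stretch 0) (hv : dv ∈ G.stretch 2) (hyu : YellowTowards σ du) (hyv : YellowTowards σ dv)
    (hsupp : ∀ x ∈ P.support, x ∈ G.verts ∧ σ x ≠ CLHexState.B)
    (hdarts : ∀ d ∈ P.darts, (clYellowGraph σ).Adj d.fst d.snd)
    (hS : ∀ x ∈ P.support, x ∉ S) :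
    σ ∈ G.dropLast.clSepEvent 1 z := by
  classical
  set Q : triGraph.Walk dv.1 du.1 := P.reverse.bypass with hQ
  have hQsupp : ∀ x ∈ Q.support, x ∈ P.support := fun x hx => by
    have := P.reverse.support_bypass_subset_support hx
    rwa [SimpleGraph.Walk.support_reverse, List.mem_reverse] at this
  have hQdarts : ∀ d ∈ Q.darts, (clYellowGraph σ).Adj d.fst d.snd := fun d hd => by
    have h1 := P.reverse.darts_bypass_subset_darts hd
    rw [SimpleGraph.Walk.darts_reverse, List.mem_reverse, List.mem_map] at h1
    obtain ⟨d', hd', rfl⟩ := h1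
    exact (hdarts d' hd').symm
  have hpath : Q.IsPath := P.reverse.bypass_isPath
  have hv1 : dv.1 ∈ G.arc 2 := Finset.mem_image_of_mem _ hv
  have hu1 : du.1 ∈ G.arc 0 := Finset.mem_image_of_mem _ hu
  have hoff : ∀ y ∈ hexFaceVertices z, y ∉ Q.support := fun y hy hyQ => hS y (hQsupp y hyQ) (hzS y hy)
  have hjoin' : ∃ y ∈ hexFaceVertices z,
      PathIn triGraph (((G.verts : Set (Site 2)) ∩ {x | x ∉ Q.support})) y (G.markSite 3) := by
    obtain ⟨y, hy, hyx⟩ := hjoin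
    exact ⟨y, hy, hyx.mono fun x hx => ⟨hx.1, fun hxQ => hS x (hQsupp x hxQ) hx.2⟩⟩
  have hsep := stub_separatesOfIsPath G dv.1 du.1 Q hpath hv1 hu1 (fun x hx => (hsupp x (hQsupp x hx)).1) z hface hoff hjoin'
  refine ⟨dv, du, Q, hpath, ?_, ?_, hyv, hyu, fun x hx => hsupp x (hQsupp x hx), hQdarts, hsep⟩
  · exact stretch_two_subset_dropLast_stretch_two G hv
  · exact hu

/-! ### The upper half of the sandwich in probability, at a fixed mesh -/

/-- **`P_{p_c}(crude) ≤ f¹(z) + local yellow arm + blue corner arms + P_{p_c}(sneak)` at a fixed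
mesh.** Let `G` be shorter–fatter than `R` at `(t, ρ)` with `2 r₂ + t < dist(A₁, A₃)`, and let
`z` be a face of `G` whose vertices are within `γ` of its centre `K`, one of them joined to `v₃`
by sites of `G` within `γ` of `K`, while the sites of `A₀(G)` are farther than `c/2` from `K`.
Then, for critical bond-`𝕋`, `P_{p_c}(crude crossing of Ω at mesh δ/√3) ≤ f¹(z) + P(yellow arm
at K from γ to c/2) + Σⱼ P(blue arm at R.pt j from ρ to r₂) + P_{p_c}(sneakEvent)`, the arm
probabilities in the Chayes–Lei representation `triBondCritical` (duality `PartSig.clDuality`,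
`clSepEvent_one_of_yellowCrossing`, and the pull-back `bond_real_preimage_clOfBond_le`). -/
theorem crude_real_le_clSepProb_add (hA : PartSig.clDuality)
    (R : ConformalRectangle) {δ t ρ r₂ γ c : ℝ}
    (hr₂ : 0 < r₂)
    (hAB : ∀ a ∈ R.arc 1, ∀ b ∈ R.arc 3, 2 * r₂ + t < dist a b)
    (G : TriMarkedDomain 4) (hG : G.IsShorterFatter R δ t ρ) {z : HexVertex}
    (hface : hexFaceVertices z ⊆ G.verts)
    (hzK : ∀ y ∈ hexFaceVertices z, dist (triMeshPoint δ y) ((δ : ℂ) * hexCenter z) < γ)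
    (hjoin : ∃ y ∈ hexFaceVertices z, PathIn triGraph
      (((G.verts : Set (Site 2)) ∩ {v | dist (triMeshPoint δ v) ((δ : ℂ) * hexCenter z) < γ})) y (G.markSite 3))
    (harc : ∀ s ∈ G.arc 0, c / 2 < dist (triMeshPoint δ s) ((δ : ℂ) * hexCenter z)) :
    (bondPercolation triGraph (criticalWeightI (Real.pi / 6))).real
        (embDomainCrossing (fun x : Site 2 ↦ (Real.sqrt 3 : ℂ) * (triEmbed x - (1 + triZeta) / 3))
          R.carrier (δ / Real.sqrt 3) (R.arc 0) (R.arc 2)) ≤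
      G.dropLast.clSepProb ChayesLeiHexPercolation.triBondCritical 1 z +
      (clHexPercolation ChayesLeiHexPercolation.triBondCritical).real
          {σ | ∃ x y : Site 2, (clYellowGraph σ).Reachable x y ∧
            ‖triMeshPoint δ x - (δ : ℂ) * hexCenter z‖ < γ ∧ c / 2 < ‖triMeshPoint δ y - (δ : ℂ) * hexCenter z‖} +
      ∑ j : Fin 4, (clHexPercolation ChayesLeiHexPercolation.triBondCritical).real
          {σ | ∃ x y : Site 2, (clBlueGraph σ).Reachable x y ∧ ‖triMeshPoint δ x - R.pt j‖ < ρ ∧ r₂ < ‖triMeshPoint δ y - R.pt j‖} +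
      (bondPercolation triGraph (criticalWeightI (Real.pi / 6))).real (sneakEvent R G δ ρ) := by
  classical
  set p : unitInterval := criticalWeightI (Real.pi / 6) with hp
  set μ := bondPercolation triGraph p with hμ
  set K : ℂ := (δ : ℂ) * hexCenter z with hKdef
  set Crude : Set (BondConfig (Site 2)) := embDomainCrossing (fun x : Site 2 ↦ (Real.sqrt 3 : ℂ) * (triEmbed x - (1 + triZeta) / 3))
      R.carrier (δ / Real.sqrt 3) (R.arc 0) (R.arc 2) with hCrude
  set Arm : Fin 4 → Set CLHexConfig := fun j =>
    {σ | ∃ x y : Site 2, (clBlueGraph σ).Reachable x y ∧ ‖triMeshPoint δ x - R.pt j‖ < ρ ∧ r₂ < ‖triMeshPoint δ y - R.pt j‖} with hArm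
  set Loc : Set CLHexConfig := {σ | ∃ x y : Site 2, (clYellowGraph σ).Reachable x y ∧
      ‖triMeshPoint δ x - K‖ < γ ∧ c / 2 < ‖triMeshPoint δ y - K‖} with hLoc
  set Sneak : Set (BondConfig (Site 2)) := sneakEvent R G δ ρ with hSneak
  set Bad : Set (BondConfig (Site 2)) := {ω | ¬ ω ⊆ triGraph.edgeSet} with hBad
  -- the configurationwise inclusion
  have hincl : Crude ⊆ (((clOfBond ⁻¹' G.dropLast.clSepEvent 1 z ∪ clOfBond ⁻¹' Loc) ∪
      ⋃ j : Fin 4, clOfBond ⁻¹' Arm j) ∪ Sneak) ∪ Bad := by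
    intro ω hω
    by_cases hωE : ω ⊆ triGraph.edgeSet
    swap
    · exact Or.inr hωE
    left
    rcases hA G (clOfBond ω) with ⟨du, dv, P, hu, hv, hyu, hyv, hsupp, hdarts⟩ | ⟨du, dv, P, hu, hv, hbu, hbv, hsupp, hdarts⟩
    · -- a yellow crossing from stretch 0 to stretch 2
      left; left
      by_cases hmeet : ∃ x ∈ P.support, dist (triMeshPoint δ x) K < γ
      · right
        obtain ⟨x, hx, hxK⟩ := hmeet
        refine ⟨x, du.1, (clYellow_reachable_ends_of_darts P hdarts hx).1, by rwa [← dist_eq_norm], ?_⟩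
        rw [← dist_eq_norm]
        exact harc du.1 (Finset.mem_image_of_mem _ hu)
      · left
        push Not at hmeet
        exact clSepEvent_one_of_yellowCrossing G hface (S := {v | dist (triMeshPoint δ v) K < γ})
          (fun y hy => hzK y hy) hjoin P hu hv hyu hyv hsupp hdarts (fun x hx hxS => absurd hxS (not_lt.2 (hmeet x hx)))
    · -- a blue crossing from stretch 1 to stretch 3
      by_cases hcorner : ∃ x ∈ P.support, ∃ j : Fin 4, dist (triMeshPoint δ x) (R.pt j) < ρ
      · left; right
        obtain ⟨x, hx, j, hxj⟩ := hcorner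
        refine mem_iUnion.2 ⟨j, ?_⟩
        obtain ⟨hxa, hxb⟩ := reachable_ends_of_darts P hdarts hx
        rcases pt_mem_arc_one_or_three R j with hj | hj
        · -- `R.pt j ∈ arc 1`: the far end is the last hexagon, on `A₃(G)`
          refine ⟨x, dv.1, hxb, by rwa [← dist_eq_norm], ?_⟩
          rw [← dist_eq_norm]
          have h3 := (hG.arc_three dv.1 (Finset.mem_image_of_mem _ hv)).1
          have := le_dist_of_infDist_le (B := R.arc 3) ⟨_, R.pt_mem_arc_self 3⟩ (fun b hb => hAB _ hj b hb) h3
          have hr : 0 ≤ t := le_trans infDist_nonneg h3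
          linarith
        · -- `R.pt j ∈ arc 3`: the far end is the first hexagon, on `A₁(G)`
          refine ⟨x, du.1, hxa, by rwa [← dist_eq_norm], ?_⟩
          rw [← dist_eq_norm]
          have h1 := (hG.arc_one du.1 (Finset.mem_image_of_mem _ hu)).1
          have := le_dist_of_infDist_le (B := R.arc 1) ⟨_, R.pt_mem_arc_self 1⟩
            (fun a ha => by rw [dist_comm]; exact hAB a ha _ hj) h1
          have hr : 0 ≤ t := le_trans infDist_nonneg h1
          linarith
      · right
        push Not at hcorner
        exact ⟨hωE, hω, du, dv, P, hu, hv, hbu, hbv, fun x hx => ⟨(hsupp x hx).1, (hsupp x hx).2, hcorner x hx⟩, hdarts⟩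
  -- the bad set is null
  have hBad0 : μ.real Bad = 0 := by
    have hae := ae_subset_edgeSet triGraph p
    rw [measureReal_def, ENNReal.toReal_eq_zero_iff]
    exact Or.inl (ae_iff.1 hae)
  -- the separating probability is the probability of the pulled-back event
  have hf : G.dropLast.clSepProb ChayesLeiHexPercolation.triBondCritical 1 z = μ.real (clOfBond ⁻¹' G.dropLast.clSepEvent 1 z) :=
    clSepProb_ofBond_eq p G.dropLast 1 z
  -- union bounds
  calc μ.real Crude
      ≤ μ.real ((((clOfBond ⁻¹' G.dropLast.clSepEvent 1 z ∪ clOfBond ⁻¹' Loc) ∪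
          ⋃ j : Fin 4, clOfBond ⁻¹' Arm j) ∪ Sneak) ∪ Bad) := measureReal_mono hincl (measure_ne_top _ _)
    _ ≤ μ.real (((clOfBond ⁻¹' G.dropLast.clSepEvent 1 z ∪ clOfBond ⁻¹' Loc) ∪
          ⋃ j : Fin 4, clOfBond ⁻¹' Arm j) ∪ Sneak) + μ.real Bad := measureReal_union_le _ _
    _ ≤ (μ.real ((clOfBond ⁻¹' G.dropLast.clSepEvent 1 z ∪ clOfBond ⁻¹' Loc) ∪
          ⋃ j : Fin 4, clOfBond ⁻¹' Arm j) + μ.real Sneak) + 0 := by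
        rw [hBad0]; exact add_le_add (measureReal_union_le _ _) le_rfl
    _ ≤ ((μ.real (clOfBond ⁻¹' G.dropLast.clSepEvent 1 z ∪ clOfBond ⁻¹' Loc) +
          μ.real (⋃ j : Fin 4, clOfBond ⁻¹' Arm j)) + μ.real Sneak) + 0 := by
        gcongr; exact measureReal_union_le _ _
    _ ≤ (((μ.real (clOfBond ⁻¹' G.dropLast.clSepEvent 1 z) + μ.real (clOfBond ⁻¹' Loc)) +
          ∑ j : Fin 4, μ.real (clOfBond ⁻¹' Arm j)) + μ.real Sneak) + 0 := by
        gcongr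
        · exact measureReal_union_le _ _
        · exact measureReal_iUnion_fintype_le _
    _ ≤ G.dropLast.clSepProb ChayesLeiHexPercolation.triBondCritical 1 z +
          (clHexPercolation ChayesLeiHexPercolation.triBondCritical).real Loc +
          ∑ j : Fin 4, (clHexPercolation ChayesLeiHexPercolation.triBondCritical).real (Arm j) + μ.real Sneak := by
        rw [add_zero, hf]
        gcongr with j
        · exact bond_real_preimage_clOfBond_le p Loc
        · exact bond_real_preimage_clOfBond_le p (Arm j)

end Summit.CriticalPhenomena.CardyFormulaZ2.Theorems.BondTriangularCardyLine

end
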